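import Literature.Analysis.FluidPDE.CKNPressureLocalization
import Literature.Analysis.FluidPDE.CKNInterpolationEstimate
import Literature.Analysis.FluidPDE.MultiplicativeInequality
import HarnessLib

/-!
# `u ∈ L^{10/3}_{t,x}` locally under `(ℋ_CKN)` (Lemarié-Rieusset 2016, (13.17)–(13.18))

Analysis/FluidPDE support file (all results proved) in the decomposition of the named fact
`Literature.Analysis.FluidPDE.LemarieRieusset2016.pressure_localIntegrability`
(`CKNMorreyLemmas.lean`), proving the first bullet of Lemarié-Rieusset 2016, p. 461: under the
hypotheses `(ℋ_CKN)` of Def. 13.4 (`LemarieRieusset2016.IsHCKNOn`, `CKNPressureLocalization.lean`)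
— in fact under its energy part alone, `u ∈ L^∞_t L²_x(Ω)` with a weak spatial gradient
`G = ∇ ⊗ u`, `∫∫_Ω |G|² < ∞`, on any `3`-dimensional real inner product space in place of `ℝ³` —
one has, for every bounded cylinder `I × B ⊆ Ω` (`I = (a, b)`, `B = B(x_B, R)`),

* (13.17) "by Sobolev inequality", for a.e. `t ∈ I`:
  `‖u(t)‖_{L⁶(B)} ≤ C_B (‖u(t)‖_{L²(B)} + ‖G(t)‖_{L²(B)})` (`exists_eLpNorm_six_le_ball`, the
  tree's embedding `W^{1,2} ⊂ L⁶` on the bounded Lipschitz domain `B`, applied to the slices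
  `u(t) ∈ W^{1,2}(B)` given by `HasWeakSpatialGradientOn.ae_hasWeakFDerivOn_slice`);
* (13.18) "by interpolation between `L^∞L²` and `L²L⁶`": `u ∈ L^{10/3}_{t,x}(I × B)`, i.e.
  `∫∫_{I × B} |u|^{10/3} < ∞` (`lintegral_rpow_ten_thirds_lt_top_of_energy`; Hölder
  `∫_B |u(t)|^{10/3} ≤ (∫_B |u(t)|²)^{2/3} ‖u(t)‖²_{L⁶(B)}` slice-wise and Tonelli), and its
  `(ℋ_CKN)` packaging `LemarieRieusset2016.IsHCKNOn.lintegral_rpow_ten_thirds_lt_top`.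

The book states both under `I × B(x_B, 2r_B) ⊆ Ω`; only `I × B ⊆ Ω` is used (the Sobolev
inequality on the ball `B` needs `u(t) ∈ W^{1,2}(B)` only), so the results are recorded in this
slightly more general form, which is the one needed for the splitting (13.20) (there the
`L^{10/3}` bound is used on the support of the cut-off `ζ_B`, inside `B(x_B, 7r_B/4)`). The
constant of (13.17) here depends on the ball (no scaling is performed), which is immaterial for
(13.18).

## References

* P. G. Lemarié-Rieusset, *The Navier–Stokes Problem in the 21st Century*, CRC Press (2016),
  (13.17)–(13.18), p. 461. [LemarieRieusset2016]
* J. C. Robinson, J. L. Rodrigo, W. Sadowski, *The Three-Dimensional Navier–Stokes Equations*,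
  CUP (2016), Lemma 3.5 (Lebesgue interpolation) and Thm. 1.7 (Sobolev embedding).
-/

noncomputable section

open MeasureTheory Set Function Filter TopologicalSpace Metric
open scoped NNReal ENNReal InnerProductSpace RealInnerProductSpace

namespace Literature.Analysis.FluidPDE

variable {E : Type*} [NormedAddCommGroup E] [InnerProductSpace ℝ E] [FiniteDimensional ℝ E]
  [MeasurableSpace E] [BorelSpace E]

/-! ### (13.17): the Sobolev inequality `H¹(B) ⊂ L⁶(B)` on a ball of `ℝ³`, weak form -/

/-- **Sobolev inequality on a ball of `ℝ³` for weakly differentiable vector fields** (on any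
`3`-dimensional real inner product space `E`, e.g. `EuclideanSpace ℝ (Fin 3)`)
(Lemarié-Rieusset 2016, (13.17): "by Sobolev inequality,
`(∫_B |u(t,x)|⁶ dx)^{1/3} ≤ C ∫_B |u|²/|B|^{2/3} + |∇ ⊗ u|² dx`"). For every ball `B = B(x_B, R)`
there is a constant `C` such that for every `f : ℝ³ → ℝ³` in `L²(B)` with a weak derivative `g`
on `B` (accepted `Literature.Analysis.FunctionSpaces.HasWeakFDerivOn`),
`‖f‖_{L⁶(B)} ≤ C (‖f‖_{L²(B)} + (∫_B |g|²)^{1/2})`, `|g|² = ∑ᵢ ‖g eᵢ‖²` the Frobenius density;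
from the tree's embedding `W^{1,2}(Ω) ⊂ L⁶(Ω)` on bounded Lipschitz domains
(`exists_eLpNorm_le_of_memSobolevDomain_one`, `isLipschitzDomain_ball`), exactly as the unit-ball
case `exists_eLpNorm_six_le_unitBall`. The constant depends on the ball (the printed
scale-invariant form is not needed here). [cite: LemarieRieusset2016, (13.17) p. 461] -/
theorem exists_eLpNorm_six_le_ball (hE3 : Module.finrank ℝ E = 3) (xB : E) (R : ℝ) :
    ∃ C : ℝ≥0, ∀ (f : E → E) (g : E → E →L[ℝ] E),
      FunctionSpaces.HasWeakFDerivOn (⟨ball xB R, isOpen_ball⟩ : Opens E) volume f g →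
      eLpNorm f 2 (volume.restrict (ball xB R)) ≠ ∞ →
      eLpNorm f 6 (volume.restrict (ball xB R)) ≤
        C * (eLpNorm f 2 (volume.restrict (ball xB R)) +
          (∫⁻ x in ball xB R, ENNReal.ofReal (frobeniusNormSq (g x))) ^ (1 / 2 : ℝ)) := by
  obtain ⟨C, hC⟩ := FunctionSpaces.exists_eLpNorm_le_of_memSobolevDomain_one (F := E)
    (FunctionSpaces.isLipschitzDomain_ball xB R) isBounded_ball (p := 2) (p' := 6) one_le_two
    (by rw [hE3]; norm_num) (by rw [hE3]; norm_num) volume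
  refine ⟨max C 1, fun f g hw hf2 => ?_⟩
  set B : Set E := ball xB R with hB
  have hg2 := eLpNorm_two_le_lintegral_frobeniusNormSq_rpow (volume.restrict B) g
  by_cases hfin : (∫⁻ x in B, ENNReal.ofReal (frobeniusNormSq (g x))) = ∞
  · rw [hfin, ENNReal.top_rpow_of_pos (by norm_num), add_top, ENNReal.mul_top (by simp)]
    exact le_top
  have hfm : AEStronglyMeasurable f (volume.restrict B) :=
    hw.locallyIntegrableOn.aestronglyMeasurable
  have hf : MemLp f 2 (volume.restrict B) := ⟨hfm, lt_top_iff_ne_top.2 hf2⟩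
  have hgm : AEStronglyMeasurable g (volume.restrict B) :=
    hw.locallyIntegrableOn_deriv.aestronglyMeasurable
  have hg : MemLp g 2 (volume.restrict B) :=
    ⟨hgm, hg2.trans_lt (ENNReal.rpow_lt_top_of_nonneg (by norm_num) hfin)⟩
  have hsob : FunctionSpaces.MemSobolevDomain 1 ((2 : ℝ≥0) : ℝ≥0∞)
      (⟨ball xB R, isOpen_ball⟩ : Opens E) volume f := by
    refine FunctionSpaces.memSobolevDomain_succ_iff.2 ⟨by exact_mod_cast hf, g, hw, fun v => ?_⟩
    rw [FunctionSpaces.memSobolevDomain_zero_iff]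
    exact_mod_cast (ContinuousLinearMap.apply ℝ E v).comp_memLp' hg
  have hS := hC f g hsob hw
  have hS' : eLpNorm f 6 (volume.restrict B) ≤
      C * (eLpNorm f 2 (volume.restrict B) + eLpNorm g 2 (volume.restrict B)) := by
    exact_mod_cast hS
  refine hS'.trans ?_
  gcongr
  exact_mod_cast le_max_left C 1

/-! ### (13.18): `u ∈ L^{10/3}_{t,x}(I × B)` -/

/-- **`u ∈ L^{10/3}_{t,x}(I × B)` for `u ∈ L^∞_t L²_x ∩ L²_t Ḣ¹_x`** (Lemarié-Rieusset 2016,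
(13.18), p. 461: "by interpolation between `L^∞L²` and `L²L⁶`, we find that
`u ∈ L^{10/3}_{t,x}(I × B)`"). Let `E` be a `3`-dimensional real inner product space (`ℝ³`),
`Ω ⊆ ℝ × E` open, `u ∈ L^∞_t L²_x(Ω)`
(`∫_{Ω_t} |u|² ≤ C` for a.e. `t`), `G` a weak spatial gradient of `u` on `Ω` with
`∫∫_Ω |G|² < ∞`, and `I × B ⊆ Ω` with `I = (a, b)`, `B = B(x_B, R)`. Then
`∫∫_{I × B} |u|^{10/3} < ∞`. Proof: for a.e. `t ∈ I` the slice `u(t)` has the weak derivative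
`G(t)` on `B` (`HasWeakSpatialGradientOn.ae_hasWeakFDerivOn_slice`) with `∫_B |u(t)|² ≤ C` and
`e(t) = ∫_B |G(t)|² < ∞`; by Hölder and (13.17),
`∫_B |u(t)|^{10/3} ≤ (∫_B |u(t)|²)^{2/3} ‖u(t)‖²_{L⁶(B)} ≤ C^{2/3} (2 C_B)² (C + e(t))`, which is
integrable over `I` (Tonelli). [cite: LemarieRieusset2016, (13.18) p. 461] -/
theorem lintegral_rpow_ten_thirds_lt_top_of_energy (hE3 : Module.finrank ℝ E = 3)
    {Ω : Opens (ℝ × E)} {u : ℝ → E → E} {G : ℝ → E → E →L[ℝ] E}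
    (hE : ∃ C : ℝ≥0, ∀ᵐ t : ℝ,
      ∫⁻ x, (Ω : Set (ℝ × E)).indicator (fun z : ℝ × E => ‖u z.1 z.2‖ₑ ^ 2) (t, x) ≤ C)
    (hG : HasWeakSpatialGradientOn Ω u G)
    (hGsq : ∫⁻ z in (Ω : Set (ℝ × E)), ENNReal.ofReal (frobeniusNormSq (G z.1 z.2)) < ∞)
    {a b : ℝ} {xB : E} {R : ℝ} (hsub : Ioo a b ×ˢ ball xB R ⊆ (Ω : Set (ℝ × E))) :
    ∫⁻ z in Ioo a b ×ˢ ball xB R, ‖u z.1 z.2‖ₑ ^ (10 / 3 : ℝ) < ∞ := by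
  obtain ⟨CS, hCS⟩ := exists_eLpNorm_six_le_ball hE3 xB R
  obtain ⟨C, hC⟩ := hE
  -- notation
  set B : Set E := ball xB R with hB
  set I : Set ℝ := Ioo a b with hI
  set BO : Opens E := ⟨ball xB R, isOpen_ball⟩ with hBO
  set Q' : Opens (ℝ × E) := ⟨Ioo a b ×ˢ (BO : Set E), isOpen_Ioo.prod BO.isOpen⟩
    with hQ'
  have hQ'Ω : Q' ≤ Ω := hsub
  have hG' : HasWeakSpatialGradientOn Q' u G := hG.mono hQ'Ω
  set A : ℝ → ℝ≥0∞ := fun t => ∫⁻ x in B, ‖u t x‖ₑ ^ (2 : ℝ) with hA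
  set e : ℝ → ℝ≥0∞ := fun t => ∫⁻ x in B, ENNReal.ofReal (frobeniusNormSq (G t x)) with he
  set c : ℝ → ℝ≥0∞ := fun t => ∫⁻ x in B, ‖u t x‖ₑ ^ (10 / 3 : ℝ) with hc
  -- measurability on the cylinder
  have hum : AEStronglyMeasurable (uncurry u) (volume.restrict (I ×ˢ B)) :=
    (hG.locallyIntegrableOn.mono_set hsub).aestronglyMeasurable
  have hGm : AEStronglyMeasurable (uncurry G) (volume.restrict (I ×ˢ B)) :=
    (hG.locallyIntegrableOn_grad.mono_set hsub).aestronglyMeasurable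
  have hprod : (volume.restrict (I ×ˢ B) : Measure (ℝ × E)) =
      (volume.restrict I).prod (volume.restrict B) := by
    rw [Measure.volume_eq_prod, Measure.prod_restrict]
  have hum103 : AEMeasurable (fun q : ℝ × E => ‖u q.1 q.2‖ₑ ^ (10 / 3 : ℝ))
      ((volume.restrict I).prod (volume.restrict B)) := by
    rw [← hprod]; exact hum.enorm.pow_const _
  have hGm2 : AEMeasurable (fun q : ℝ × E => ENNReal.ofReal (frobeniusNormSq (G q.1 q.2)))
      ((volume.restrict I).prod (volume.restrict B)) := by
    rw [← hprod]
    exact (continuous_frobeniusNormSq'.comp_aestronglyMeasurable hGm).aemeasurable.ennreal_ofReal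
  -- Tonelli
  have hCeq : ∫⁻ z in I ×ˢ B, ‖u z.1 z.2‖ₑ ^ (10 / 3 : ℝ) = ∫⁻ t in I, c t := by
    rw [Measure.volume_eq_prod, setLIntegral_prod _ (by rwa [← Measure.prod_restrict])]
  have hEeq : ∫⁻ z in I ×ˢ B, ENNReal.ofReal (frobeniusNormSq (G z.1 z.2)) = ∫⁻ t in I, e t :=
    by
    rw [Measure.volume_eq_prod, setLIntegral_prod _ (by rwa [← Measure.prod_restrict])]
  have hem : AEMeasurable e (volume.restrict I) := hGm2.lintegral_prod_right'
  have hEfin : ∫⁻ t in I, e t < ∞ := by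
    rw [← hEeq]; exact (lintegral_mono_set hsub).trans_lt hGsq
  -- a.e. in time: energy bound, finite dissipation, weak derivative of the slice
  have h1 : ∀ᵐ t ∂(volume.restrict I), A t ≤ C := by
    rw [ae_restrict_iff' measurableSet_Ioo]
    filter_upwards [hC] with t ht htI
    refine le_trans ?_ ht
    have hAt : A t = ∫⁻ x, B.indicator (fun x => ‖u t x‖ₑ ^ (2 : ℝ)) x := by
      rw [hA, lintegral_indicator measurableSet_ball]
    rw [hAt]
    refine lintegral_mono fun x => ?_
    by_cases hx : x ∈ B
    · rw [indicator_of_mem hx, indicator_of_mem (hsub (mk_mem_prod htI hx))]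
      rw [show (2 : ℝ) = ((2 : ℕ) : ℝ) by norm_num, ENNReal.rpow_natCast]
    · rw [indicator_of_notMem hx]
      exact zero_le
  have h2 : ∀ᵐ t ∂(volume.restrict I), e t < ∞ := ae_lt_top' hem hEfin.ne
  have h3 : ∀ᵐ t ∂(volume.restrict I), FunctionSpaces.HasWeakFDerivOn BO volume (u t) (G t) :=
    hG'.ae_hasWeakFDerivOn_slice
  -- the pointwise-in-time estimate
  set K : ℝ≥0∞ := (C : ℝ≥0∞) ^ (2 / 3 : ℝ) * ((2 * CS : ℝ≥0) : ℝ≥0∞) ^ (2 : ℝ) with hK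
  have hKtop : K ≠ ∞ := ENNReal.mul_ne_top (ENNReal.rpow_ne_top_of_nonneg (by norm_num) (by simp))
    (ENNReal.rpow_ne_top_of_nonneg (by norm_num) ENNReal.coe_ne_top)
  have hpt : ∀ᵐ t ∂(volume.restrict I), c t ≤ K * (C + e t) := by
    filter_upwards [h1, h2, h3] with t hat het hwt
    have hat' : A t ≠ ∞ := ne_top_of_le_ne_top (by simp) hat
    have hutm : AEStronglyMeasurable (u t) (volume.restrict B) :=
      hwt.locallyIntegrableOn.aestronglyMeasurable
    -- `‖u t‖_{L²(B)} = A(t)^{1/2}`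
    have hL2 : eLpNorm (u t) 2 (volume.restrict B) = A t ^ (1 / 2 : ℝ) := by
      rw [eLpNorm_eq_lintegral_rpow_enorm_toReal two_ne_zero ENNReal.ofNat_ne_top,
        ENNReal.toReal_ofNat, hA, one_div]
    have hL2' : eLpNorm (u t) 2 (volume.restrict B) ≠ ∞ := by
      rw [hL2]; exact ENNReal.rpow_ne_top_of_nonneg (by norm_num) hat'
    -- Sobolev on the slice
    have hS : eLpNorm (u t) 6 (volume.restrict B) ≤
        ((2 * CS : ℝ≥0) : ℝ≥0∞) * (A t + e t) ^ (1 / 2 : ℝ) := by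
      have h0 := hCS (u t) (G t) hwt hL2'
      rw [hL2] at h0
      refine h0.trans ?_
      have h1' : A t ^ (1 / 2 : ℝ) ≤ (A t + e t) ^ (1 / 2 : ℝ) :=
        ENNReal.rpow_le_rpow le_self_add (by norm_num)
      have h2' : e t ^ (1 / 2 : ℝ) ≤ (A t + e t) ^ (1 / 2 : ℝ) :=
        ENNReal.rpow_le_rpow le_add_self (by norm_num)
      calc (CS : ℝ≥0∞) * (A t ^ (1 / 2 : ℝ) + e t ^ (1 / 2 : ℝ))
          ≤ CS * ((A t + e t) ^ (1 / 2 : ℝ) + (A t + e t) ^ (1 / 2 : ℝ)) := by gcongr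
        _ = ((2 * CS : ℝ≥0) : ℝ≥0∞) * (A t + e t) ^ (1 / 2 : ℝ) := by push_cast; ring
    -- `(∫ |u t|⁶)^{1/3} = ‖u t‖_{L⁶}²`
    have hL6 : (∫⁻ x in B, ‖u t x‖ₑ ^ (6 : ℝ)) ^ (1 / 3 : ℝ) =
        eLpNorm (u t) 6 (volume.restrict B) ^ (2 : ℝ) := by
      rw [eLpNorm_eq_lintegral_rpow_enorm_toReal (by norm_num) ENNReal.ofNat_ne_top,
        ENNReal.toReal_ofNat, ← ENNReal.rpow_mul]
      norm_num
    -- Hölder in space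
    have hH := lintegral_enorm_rpow_ten_thirds_le (μ := volume.restrict B) hutm
    calc c t ≤ A t ^ (2 / 3 : ℝ) * (∫⁻ x in B, ‖u t x‖ₑ ^ (6 : ℝ)) ^ (1 / 3 : ℝ) := hH
      _ = A t ^ (2 / 3 : ℝ) * eLpNorm (u t) 6 (volume.restrict B) ^ (2 : ℝ) := by rw [hL6]
      _ ≤ (C : ℝ≥0∞) ^ (2 / 3 : ℝ) *
            (((2 * CS : ℝ≥0) : ℝ≥0∞) * (A t + e t) ^ (1 / 2 : ℝ)) ^ (2 : ℝ) := by gcongr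
      _ = K * (A t + e t) := by
          rw [hK, ENNReal.mul_rpow_of_nonneg _ _ (by norm_num), ← ENNReal.rpow_mul,
            show (1 / 2 : ℝ) * 2 = 1 by norm_num, ENNReal.rpow_one]
          ring
      _ ≤ K * (C + e t) := by gcongr
  -- integrate in time
  have hIfin : volume I ≠ ∞ := by rw [hI]; exact measure_Ioo_lt_top.ne
  calc ∫⁻ z in I ×ˢ B, ‖u z.1 z.2‖ₑ ^ (10 / 3 : ℝ) = ∫⁻ t in I, c t := hCeq
    _ ≤ ∫⁻ t in I, K * (C + e t) := lintegral_mono_ae hpt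
    _ = K * ((C : ℝ≥0∞) * volume I + ∫⁻ t in I, e t) := by
        rw [lintegral_const_mul' _ _ hKtop, lintegral_add_left' aemeasurable_const, lintegral_const,
          Measure.restrict_apply_univ]
    _ < ∞ := ENNReal.mul_lt_top hKtop.lt_top (ENNReal.add_lt_top.2
        ⟨ENNReal.mul_lt_top ENNReal.coe_lt_top hIfin.lt_top, hEfin⟩)

namespace LemarieRieusset2016

/-- **(13.18) under `(ℋ_CKN)`**: if `(u, p, f)` satisfies the hypotheses `(ℋ_CKN)` of
Lemarié-Rieusset 2016, Def. 13.4 on `Ω` and `I × B ⊆ Ω` is a cylinder (`I = (a, b)`,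
`B = B(x_B, R)`), then `u ∈ L^{10/3}_{t,x}(I × B)`: `∫∫_{I × B} |u|^{10/3} < ∞` (the book asks
`I × B(x_B, 2R) ⊆ Ω`, which is more than is used). [cite: LemarieRieusset2016, (13.18) p. 461] -/
theorem IsHCKNOn.lintegral_rpow_ten_thirds_lt_top {Ω ν q₀ f u p G}
    (h : IsHCKNOn Ω ν q₀ f u p G) {a b : ℝ} {xB : EuclideanSpace ℝ (Fin 3)} {R : ℝ}
    (hsub : Ioo a b ×ˢ ball xB R ⊆ (Ω : Set (ℝ × EuclideanSpace ℝ (Fin 3)))) :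
    ∫⁻ z in Ioo a b ×ˢ ball xB R, ‖u z.1 z.2‖ₑ ^ (10 / 3 : ℝ) < ∞ :=
  lintegral_rpow_ten_thirds_lt_top_of_energy finrank_euclideanSpace_three h.energy
    h.hasWeakSpatialGradientOn h.gradient_sq_lt_top hsub

end LemarieRieusset2016

end Literature.Analysis.FluidPDE
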